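import Literature.AnabelianGeometry.AbsoluteAnabelian.AbsTopIII.KummerCurveLaws
import HarnessLib

/-!
# [AbsTopIII] §1: per-curve LAWS of the model interface, II — base-change legs `Z ×_{k_Z} k′ → Z`
# (successor structure `TowerKummerModel extends NaturalKummerModel`)

Mochizuki, *Topics in Absolute Anabelian Geometry III*, §1 (manuscript pages, lit key
`paper:url-5493eb38cbb7`): Thm. 1.9 (d) p. 37 "`lim_{→V} H¹(Π_V, μ_Ẑ(Π_U))` — where `V` ranges over the
open subschemes obtained by removing finite collections of NF-points from `Z ×_{k_Z} k′`, for `k′` a finite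
extension of `k_Z`"; Thm. 1.9 p. 38 "the asserted 'functoriality' is [...] with respect to homomorphisms of
extensions of profinite groups arising from a base-change of the base field"; Def. 1.7 (ii) p. 35
(NF-points, NF-rational functions, NF-constants "that descend to `k̄_NF`"); Prop. 1.6 p. 34 "the associated
Kummer map".

`NaturalKummerModel` (`KummerCurveLaws.lean`, abc-iut-L4-t1) carries the laws along COFINITE OPENS
`U ⊆ X`.  The directed system of Thm. 1.9 (d) also runs over BASE CHANGES `Z ×_{k_Z} k′ → Z`, which the
one-base-field interface `CurveModel` records only by their group-theoretic shadow
(`FundamentalExtension.Hom.IsBaseChange`, `Hom.IsOpenInjective`) on bare homomorphisms (abc-iut-w5-d213's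
`NFComplementSystem.bc`, GAP-LEDGER G-w5d213-2).  THIS FILE is the interface owner's successor structure
`TowerKummerModel extends NaturalKummerModel` recording base changes as a RELATION of the model with their
laws (cell abc-iut, abc-iut-L4-lead RULINGS #3y/#3z; field shapes requested by abc-iut-w5-d213 2026-08-26
04:41Z for the bridge `NFTower.ofCurveLaws`):

* (B) `IsBaseChangeOf Z′ Z` ("`Z′ = Z ×_{k_Z} k′`, `k′` a finite extension of `k_Z`") with the leg
  `bc : Π_{Z′} → Π_Z` (a base-change homomorphism, open injective), reflexive/transitive with strict
  functoriality, the field maps `k_Z ↪ k′` (finite), `K_Z ↪ K_{Z′}` and `k′ ↪ k̄_Z` (coherent along towers),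
  the image of closed points (`bcPt`, unramified: `ord` is preserved), decomposition groups, cusps,
  transport of the curve predicates, and RICHNESS (every finite `k′ ⊆ k̄_Z` is realised; nested subfields
  give nested base changes);
* (B×O) compatibility of base change with cofinite opens (`U ×_Z Z′ ⊆ Z′`: the squares of homomorphisms,
  fields and points commute; such opens exist in the model);
* (N′) NATURALITY of the Kummer map under base change WITH CHANGE OF COEFFICIENTS `M_{X′} ⥲ M_X`
  (`cyclotomeModH1Push` / `cyclotomeModH1Pull`, abc-iut-w5-d213's `Thm19Steps.lean`), in the exact
  cohomological shape the per-system view `NFTower.naturality` consumes.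

Every field is an INTERFACE LAW (typing policy θ): TRUE at the intended étale-`π₁` model with coherent
(generic-point) base points and coherent embeddings `k′ ⊆ k̄_Z`; NOT a published prerequisite, NOT a named
Prop fact; no instance is asserted.  The descent data `K_{Z_NF} ⊆ K_{Z_{k̄}}` and the places of `K_{Z_NF}`
(G-w5d213-2 (d), G-w5d213-3 (e0)–(e3)) are the sequel file `KummerDescentLaws.lean`.  HONEST FRAMING:
statements-first interface laws; typed ≠ proved; nothing here bears on [IUTchIII] Cor. 3.12.
-/

noncomputable section

open CategoryTheory
open scoped Classical Pointwise

namespace Literature.AnabelianGeometry.AbsoluteAnabelian.AbsTopIII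

universe u

/-- **The model interface with its base-change legs** (successor of `NaturalKummerModel`; cell abc-iut
GAP-LEDGER G-w5d213-2, interface owner abc-iut-L4-t1): a `NaturalKummerModel` TOGETHER WITH the relation
"`Z′ = Z ×_{k_Z} k′` for `k′` a finite extension of `k_Z`" (Thm. 1.9 (d) p. 37) between curves of the
model, the homomorphisms of extensions "arising from a base-change of the base field" (Thm. 1.9 p. 38) it
induces, the accompanying maps of base fields, function fields and closed points, and their laws —
including the naturality of the Kummer map under base change with the identification of coefficient
cyclotomes `μ_Ẑ(Π_U) := M_Z` (Thm. 1.9 (d)).  INTERFACE (typing policy θ); no instance is asserted.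
[cite: MochizukiAbsTopIII2015, Thm 1.9 (d) p.37] -/
structure TowerKummerModel : Type (u + 2) extends NaturalKummerModel.{u} where
  /-- (B) "`Z ×_{k_Z} k′`, for `k′` a finite extension of `k_Z`" (Thm. 1.9 (d) p. 37): `Z′` is the base
  change of `Z` to a finite extension of its base field (inside `k̄_Z`). -/
  IsBaseChangeOf : Curve → Curve → Prop
  /-- (B) the homomorphism of extensions "arising from a base-change of the base field" (Thm. 1.9 p. 38):
  `Π_{Z′} = Π_Z ×_{G_k} G_{k′} → Π_Z`. -/
  bc : ∀ {Z' Z : Curve}, IsBaseChangeOf Z' Z → (ext Z' ⟶ ext Z)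
  /-- (B) it is a base-change homomorphism in the group-theoretic sense (`Δ_{Z′} ⥲ Δ_Z`). -/
  isBaseChange_bc : ∀ {Z' Z : Curve} (h : IsBaseChangeOf Z' Z), (bc h).IsBaseChange
  /-- (B) it is open injective (`k′/k_Z` finite: `G_{k′} ⊆ G_{k_Z}` and `Π_{Z′} ⊆ Π_Z` open). -/
  isOpenInjective_bc : ∀ {Z' Z : Curve} (h : IsBaseChangeOf Z' Z), (bc h).IsOpenInjective
  /-- (B) the trivial base change `k′ = k_Z`. -/
  isBaseChangeOf_refl : ∀ Z : Curve, IsBaseChangeOf Z Z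
  /-- (B) base changes compose ("finite extension of a finite extension"). -/
  isBaseChangeOf_trans : ∀ {Z'' Z' Z : Curve}, IsBaseChangeOf Z'' Z' → IsBaseChangeOf Z' Z →
    IsBaseChangeOf Z'' Z
  /-- (B) the trivial base change induces the identity. -/
  bc_refl : ∀ Z : Curve, bc (isBaseChangeOf_refl Z) = 𝟙 (ext Z)
  /-- (B) strict functoriality of the legs along `Z″ → Z′ → Z` (coherent base points). -/
  bc_comp : ∀ {Z'' Z' Z : Curve} (h₁ : IsBaseChangeOf Z'' Z') (h₂ : IsBaseChangeOf Z' Z)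
    (h : IsBaseChangeOf Z'' Z), bc h₁ ≫ bc h₂ = bc h
  /-- (B) the inclusion of base fields `k_Z ↪ k′`. -/
  bcBase : ∀ {Z' Z : Curve}, IsBaseChangeOf Z' Z → (base Z →+* base Z')
  /-- (B) "`k′` a finite extension of `k_Z`". -/
  finite_bcBase : ∀ {Z' Z : Curve} (h : IsBaseChangeOf Z' Z), (bcBase h).Finite
  /-- (B) the inclusion of function fields `K_Z ↪ K_{Z′} = K_Z ⊗_{k_Z} k′`. -/
  bcField : ∀ {Z' Z : Curve}, IsBaseChangeOf Z' Z → (FunctionField Z →+* FunctionField Z')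
  /-- (B) the square of structure maps `k_Z → K_Z`, `k′ → K_{Z′}` commutes. -/
  bcField_algebraMap : ∀ {Z' Z : Curve} (h : IsBaseChangeOf Z' Z) (c : base Z),
    bcField h (algebraMap (base Z) (FunctionField Z) c) =
      algebraMap (base Z') (FunctionField Z') (bcBase h c)
  /-- (B) trivial base change: identity on base fields. -/
  bcBase_refl : ∀ Z : Curve, bcBase (isBaseChangeOf_refl Z) = RingHom.id (base Z)
  /-- (B) trivial base change: identity on function fields. -/
  bcField_refl : ∀ Z : Curve, bcField (isBaseChangeOf_refl Z) = RingHom.id (FunctionField Z)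
  /-- (B) transitivity of the base-field inclusions along `Z″ → Z′ → Z`. -/
  bcBase_comp : ∀ {Z'' Z' Z : Curve} (h₁ : IsBaseChangeOf Z'' Z') (h₂ : IsBaseChangeOf Z' Z)
    (h : IsBaseChangeOf Z'' Z), (bcBase h₁).comp (bcBase h₂) = bcBase h
  /-- (B) transitivity of the function-field inclusions along `Z″ → Z′ → Z`. -/
  bcField_comp : ∀ {Z'' Z' Z : Curve} (h₁ : IsBaseChangeOf Z'' Z') (h₂ : IsBaseChangeOf Z' Z)
    (h : IsBaseChangeOf Z'' Z), (bcField h₁).comp (bcField h₂) = bcField h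
  /-- (B) "`k′ ⊆ k̄`": the base field of `Z′` inside the algebraic closure of `k_Z`, over `k_Z` (the
  tower `k′_i ⊆ k̄` of Thm. 1.9 (d); abc-iut-w5-d213's `NFTower.baseEmb`). -/
  bcEmb : ∀ {Z' Z : Curve}, IsBaseChangeOf Z' Z → (base Z' →+* AlgebraicClosure (base Z))
  /-- (B) `k_Z → k′ → k̄` is the structure map of `k̄ / k_Z`. -/
  bcEmb_comp_bcBase : ∀ {Z' Z : Curve} (h : IsBaseChangeOf Z' Z),
    (bcEmb h).comp (bcBase h) = algebraMap (base Z) (AlgebraicClosure (base Z))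
  /-- (B) coherence of the embeddings `k″ ⊇ k′` inside `k̄` along `Z″ → Z′ → Z`. -/
  bcEmb_comp_bcBase' : ∀ {Z'' Z' Z : Curve} (h₁ : IsBaseChangeOf Z'' Z') (h₂ : IsBaseChangeOf Z' Z)
    (h : IsBaseChangeOf Z'' Z), (bcEmb h).comp (bcBase h₁) = bcEmb h₂
  /-- (B) trivial base change: `k_Z ⊆ k̄` is the structure map. -/
  bcEmb_refl : ∀ Z : Curve,
    bcEmb (isBaseChangeOf_refl Z) = algebraMap (base Z) (AlgebraicClosure (base Z))
  /-- (R) RICHNESS: "for `k′` a[ny] finite extension of `k_Z`" (Thm. 1.9 (d) p. 37) — every finite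
  subextension `k′ ⊆ k̄` of `k_Z` is the base field of a base change of `Z` in the model. -/
  exists_baseChange : ∀ (Z : Curve) (K : IntermediateField (base Z) (AlgebraicClosure (base Z))),
    FiniteDimensional (base Z) K → ∃ (Z' : Curve) (h : IsBaseChangeOf Z' Z),
      Set.range (bcEmb h) = (K : Set (AlgebraicClosure (base Z)))
  /-- (R) nested base fields `k′ ⊆ k″ ⊆ k̄` give nested base changes `Z″ → Z′` (`Z″ = Z′ ×_{k′} k″`). -/
  isBaseChangeOf_of_range_subset : ∀ {Z'' Z' Z : Curve} (h₁ : IsBaseChangeOf Z' Z)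
    (h₂ : IsBaseChangeOf Z'' Z), Set.range (bcEmb h₁) ⊆ Set.range (bcEmb h₂) → IsBaseChangeOf Z'' Z'
  /-- (B) the image in `Z` of a closed point of `Z′` (fibres of `Z′ → Z`). -/
  bcPt : ∀ {Z' Z : Curve}, IsBaseChangeOf Z' Z → Point Z' → Point Z
  /-- (B) every closed point of `Z` has a point of `Z′` above it. -/
  bcPt_surjective : ∀ {Z' Z : Curve} (h : IsBaseChangeOf Z' Z), Function.Surjective (bcPt h)
  /-- (B) trivial base change: identity on points. -/
  bcPt_refl : ∀ (Z : Curve) (x : Point Z), bcPt (isBaseChangeOf_refl Z) x = x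
  /-- (B) transitivity of the point maps along `Z″ → Z′ → Z`. -/
  bcPt_comp : ∀ {Z'' Z' Z : Curve} (h₁ : IsBaseChangeOf Z'' Z') (h₂ : IsBaseChangeOf Z' Z)
    (h : IsBaseChangeOf Z'' Z) (x : Point Z''), bcPt h₂ (bcPt h₁ x) = bcPt h x
  /-- (B) base change of the base field is UNRAMIFIED: `ord_{x′}(f) = ord_x(f)` for `x′` over `x` and
  `f ∈ K_Z^×` ("`ord_x : K_X^× → ℤ`", Prop. 1.3 (b) p. 30). -/
  ord_bcPt : ∀ {Z' Z : Curve} (h : IsBaseChangeOf Z' Z) (x' : Point Z') (f : (FunctionField Z)ˣ),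
    ord x' (Units.map (bcField h).toMonoidHom f) = ord (bcPt h x') f
  /-- (B) the decomposition group of `x′` in `Π_{Z′}` maps into a decomposition group of its image `x`
  (an open subgroup of it: `G_{k′(x′)} ⊆ G_{k(x)}`). -/
  decomp_bcPt : ∀ {Z' Z : Curve} (h : IsBaseChangeOf Z' Z) (x' : Point Z'), ∃ g : (ext Z).arith,
    (decomp Z' x').map (bc h).arith.toMonoidHom ≤ MulAut.conj g • decomp Z (bcPt h x')
  /-- (B) a point over a `k_Z`-rational point is `k′`-rational (`x ×_{k} k′` is one `k′`-point). -/
  isRationalPt_of_bcPt : ∀ {Z' Z : Curve} (h : IsBaseChangeOf Z' Z) (x' : Point Z'),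
    IsRationalPt Z (bcPt h x') → IsRationalPt Z' x'
  /-- (B)/Def. 1.7 (ii): for an NF-curve `Z`, a point of `Z′` is an NF-point iff its image is ("points of
  `X(k̄)` [...] that descend to `k̄_NF`", p. 35 — a property of the geometric point). -/
  isNFPoint_bcPt : ∀ {Z' Z : Curve} (h : IsBaseChangeOf Z' Z), IsNFCurve Z → ∀ x' : Point Z',
    IsNFPoint Z' x' ↔ IsNFPoint Z (bcPt h x')
  /-- (B) every cusp of `Z′` lies over a cusp of `Z`: its decomposition group maps into a conjugate of a
  cuspidal decomposition group of `Z`. -/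
  exists_cusp_bc : ∀ {Z' Z : Curve} (h : IsBaseChangeOf Z' Z) (c' : (cusps Z').Cusp),
    ∃ (c : (cusps Z).Cusp) (g : (ext Z).arith),
      ((cusps Z').Dcusp c').map (bc h).arith.toMonoidHom ≤ MulAut.conj g • (cusps Z).Dcusp c
  /-- (B) a cusp over a `k_Z`-rational cusp is `k′`-rational ("the points of `Z ∖ U` are all rational",
  Thm. 1.9 (b) p. 37, is preserved under base change). -/
  isRational_cusp_bc : ∀ {Z' Z : Curve} (h : IsBaseChangeOf Z' Z) (c' : (cusps Z').Cusp)
    (c : (cusps Z).Cusp) (g : (ext Z).arith),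
    ((cusps Z').Dcusp c').map (bc h).arith.toMonoidHom ≤ MulAut.conj g • (cusps Z).Dcusp c →
      (cusps Z).IsRational c → (cusps Z').IsRational c'
  /-- (B) base change preserves scheme-likeness. -/
  isScheme_bc : ∀ {Z' Z : Curve}, IsBaseChangeOf Z' Z → (IsScheme Z' ↔ IsScheme Z)
  /-- (B) base change preserves properness. -/
  isProper_bc : ∀ {Z' Z : Curve}, IsBaseChangeOf Z' Z → (IsProper Z' ↔ IsProper Z)
  /-- (B) base change preserves the genus (abc-iut-w5-d213's `NFComplementSystem.genus_eq`). -/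
  genus_bc : ∀ {Z' Z : Curve}, IsBaseChangeOf Z' Z → genus Z' = genus Z
  /-- (B)/Def. 1.7 (i): `Z′` is an NF-curve iff `Z` is (`Z′_{k̄} = Z_{k̄}`). -/
  isNFCurve_bc : ∀ {Z' Z : Curve}, IsBaseChangeOf Z' Z → (IsNFCurve Z' ↔ IsNFCurve Z)
  /-- (B)/Def. 1.7 (ii): for an NF-curve, NF-rationality of `g ∈ K_Z` is unchanged in `K_{Z′}`. -/
  isNFRational_bcField : ∀ {Z' Z : Curve} (h : IsBaseChangeOf Z' Z), IsNFCurve Z →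
    ∀ g : FunctionField Z, IsNFRational Z' (bcField h g) ↔ IsNFRational Z g
  /-- (B)/Def. 1.7 (ii): for an NF-curve, being an NF-constant is unchanged under `k_Z ⊆ k′`. -/
  isNFConstant_bcBase : ∀ {Z' Z : Curve} (h : IsBaseChangeOf Z' Z), IsNFCurve Z →
    ∀ c : base Z, IsNFConstant Z' (bcBase h c) ↔ IsNFConstant Z c
  /-- (B)/Def. 1.7 (ii) "NF-constants [...] that descend to `k̄_NF`": for an NF-curve `Z`, `c′ ∈ k′` is an
  NF-constant of `Z′` iff `c′ ∈ k̄_NF` inside `k̄` (abc-iut-w5-d213's `NFTower.isNFConstant_iff_mem`). -/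
  isNFConstant_iff_mem_kbarNF : ∀ {Z' Z : Curve} (h : IsBaseChangeOf Z' Z), IsNFCurve Z →
    ∀ c' : base Z', IsNFConstant Z' c' ↔ bcEmb h c' ∈ toCurveModel.kbarNF Z
  /-- (B×O) for `U ⊆ Z` a cofinite open and base changes `U′ → U`, `Z′ → Z` with `U′ ⊆ Z′` a cofinite
  open (`U′ = U ×_Z Z′`): the square of homomorphisms `Π_{U′} → Π_U → Π_Z`, `Π_{U′} → Π_{Z′} → Π_Z`
  commutes (coherent base points; the square `W_ij ⊆ Zb_j` over `V_i ⊆ Zb_i` of abc-iut-w5-d213). -/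
  bc_res_comm : ∀ {U U' Z Z' : Curve} (hU : IsBaseChangeOf U' U) (hZ : IsBaseChangeOf Z' Z)
    (h : IsCofiniteOpen U Z) (h' : IsCofiniteOpen U' Z'), bc hU ≫ res h = res h' ≫ bc hZ
  /-- (B×O) the same square on function fields (`K_U = K_Z ⊆ K_{Z′} = K_{U′}`). -/
  bcField_fieldRes : ∀ {U U' Z Z' : Curve} (hU : IsBaseChangeOf U' U) (hZ : IsBaseChangeOf Z' Z)
    (h : IsCofiniteOpen U Z) (h' : IsCofiniteOpen U' Z') (f : FunctionField Z),
    bcField hU (fieldRes h f) = fieldRes h' (bcField hZ f)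
  /-- (B×O) the same square on base fields. -/
  bcBase_baseRes : ∀ {U U' Z Z' : Curve} (hU : IsBaseChangeOf U' U) (hZ : IsBaseChangeOf Z' Z)
    (h : IsCofiniteOpen U Z) (h' : IsCofiniteOpen U' Z') (c : base Z),
    bcBase hU (baseRes h c) = baseRes h' (bcBase hZ c)
  /-- (B×O)/(R) model closure: the open `U ×_Z Z′ ⊆ Z′` exists in the model ("removing finite
  collections of NF-points from `Z ×_{k_Z} k′`", Thm. 1.9 (d) p. 37). -/
  exists_bc_open : ∀ {U Z Z' : Curve}, IsCofiniteOpen U Z → IsBaseChangeOf Z' Z →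
    ∃ U' : Curve, IsBaseChangeOf U' U ∧ IsCofiniteOpen U' Z'
  /-- (B×O) the points of `U′ = U ×_Z Z′` map to points of `U` compatibly with the inclusions. -/
  bcPt_ptRes : ∀ {U U' Z Z' : Curve} (hU : IsBaseChangeOf U' U) (hZ : IsBaseChangeOf Z' Z)
    (h : IsCofiniteOpen U Z) (h' : IsCofiniteOpen U' Z') (x' : Point U'),
    ptRes h (bcPt hU x') = bcPt hZ (ptRes h' x')
  /-- (N′) **NATURALITY of the Kummer map under base change, with change of coefficients** ("the
  associated Kummer map", Prop. 1.6 p. 34; "`μ_Ẑ(Π_U) := M_Z`" for all levels `V ⊆ Z ×_{k_Z} k′`, Thm. 1.9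
  (d) p. 37; functoriality "arising from a base-change of the base field", p. 38): for `U ⊆ X`,
  `U′ ⊆ X′` cofinite opens with `X` proper and base changes `U′ → U`, `X′ → X`, and a regular unit `f` of
  `U` with pull-back `f′ := f ∘ (U′ → U)` (a regular unit of `U′` by `ord_bcPt`), the class `κ_{U′}(f′)`
  pushed along `M_{X′} ⥲ M_X` (`cyclotomeModH1Push`) equals `κ_U(f)` pulled back along `Π_{U′} → Π_U` over
  `Π_X` (`cyclotomeModH1Pull`) — both in `H¹(Π_{U′}, M_X)`. -/
  kummer_bc : ∀ {U U' X X' : Curve} (hU : IsBaseChangeOf U' U) (hX : IsBaseChangeOf X' X)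
    (h : IsCofiniteOpen U X) (h' : IsCofiniteOpen U' X') (hXp : IsProper X) (hX'p : IsProper X')
    (f : toDivisorCurveModel.regularUnits U)
    (hf : Units.map (bcField hU).toMonoidHom (f : (FunctionField U)ˣ) ∈
      toDivisorCurveModel.regularUnits U'),
    (cyclotomeModH1Push ZHatCoeff.{u} (res h') (bc hX)).hom
        (toIntrinsicKummerModel.kummerAddHom h' hX'p (Additive.ofMul ⟨_, hf⟩)) =
      (cyclotomeModH1Pull ZHatCoeff.{u} (bc hU) (res h) (res h' ≫ bc hX)
          (bc_res_comm hU hX h h')).hom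
        (toIntrinsicKummerModel.kummerAddHom h hXp (Additive.ofMul f))

end Literature.AnabelianGeometry.AbsoluteAnabelian.AbsTopIII
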